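import Summits.AtomisticToContinuum.BoseEinsteinCondensation.Theorems.GaussianDominationCan.Negative.ProductStatesConst
import Literature.MathematicalPhysics.QuantumManyBody.PeriodicBoseGasImpurityTranslation

/-!
# Crux `GaussianDominationCan` in named vocabulary; chord ⇔ square; the top corner of the window

Support file (crux disprover, `stmt-AtomisticToContinuum-9479`).  `GDIneq`/`InWindow`/`GDCanWith`
(the crux is `∀ v M, ∃ ρ₀ C N₀, GDCanWith ρ₀ C N₀ v M` by `Iff.rfl`), the square (susceptibility)
form `forall_gdIneq_iff`, the window geometry (`one_le_norm_intVec`, `corner`: the ultra-dilute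
corner `L = M²N/4π²`, `n = e₀` is admissible), and the decorative guards
(`gaussianDominationCan_iff_bare`).  All [folklore].
-/

noncomputable section

namespace Summit.AtomisticToContinuum.BoseEinsteinCondensation.Theorems.GaussianDominationCan.Negative

open MeasureTheory Literature.MathematicalPhysics.QuantumManyBody.BoseGas
open scoped ENNReal NNReal ComplexConjugate

variable {N : ℕ} {L : ℝ}

/-! ## The crux in named vocabulary -/

section Crux

/-- The crux inequality at fixed data (`Φ` a periodic Bose trial state). -/
def GDIneq (v : ℝ → ℝ≥0∞) (m : ℕ) (L : ℝ) (n : Fin 3 → ℤ) (C s : ℝ)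
    (Φ : PeriodicTrialState (m + 1) L) : Prop :=
  periodicGroundStateEnergy v (m + 1) L +
      ENNReal.ofReal (s * (2 * (m + 1) * ‖sourceIntegral m L n Φ.ψ‖)) ≤
    periodicEnergy v Φ + ENNReal.ofReal (C * s ^ 2 * L ^ 2 / ‖(fun j => (n j : ℝ))‖ ^ 2)

/-- The window condition `|k| ≤ M √ρ` (note: SUP norm on `n`). -/
def InWindow (M : ℝ) (m : ℕ) (L : ℝ) (n : Fin 3 → ℤ) : Prop :=
  2 * Real.pi * ‖(fun j => (n j : ℝ))‖ / L ≤ M * Real.sqrt ((m + 1 : ℕ) / L ^ 3)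

/-- The crux with its constants `ρ₀, C, N₀` exposed (for fixed `v`, `M`). -/
def GDCanWith (ρ₀ C : ℝ) (N₀ : ℕ) (v : ℝ → ℝ≥0∞) (M : ℝ) : Prop :=
  ∀ m : ℕ, N₀ ≤ m + 1 → ∀ L : ℝ, 0 < L → ((m + 1 : ℕ) : ℝ) ≤ ρ₀ * L ^ 3 →
    ∀ n : Fin 3 → ℤ, n ≠ 0 → InWindow M m L n → ∀ s : ℝ, 0 ≤ s →
      ∀ Φ : PeriodicTrialState (m + 1) L, GDIneq v m L n C s Φ

/-- **The crux, verbatim, in named vocabulary** (definitional unfolding only). -/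
theorem gaussianDominationCan_iff :
    Summit.AtomisticToContinuum.BoseEinsteinCondensation.Theses.BECThomsonPrinciple.GaussianDominationCan ↔
      ∀ v : ℝ → ℝ≥0∞, IsRepulsiveFiniteRange v → ∀ M : ℝ, 0 < M →
        ∃ ρ₀ C : ℝ, 0 < ρ₀ ∧ 0 < C ∧ ∃ N₀ : ℕ, GDCanWith ρ₀ C N₀ v M :=
  Iff.rfl

/-- The crux inequality is monotone in the constant `C`. [folklore] -/
theorem GDIneq.mono_C {v : ℝ → ℝ≥0∞} {m : ℕ} {n : Fin 3 → ℤ} {C C' s : ℝ}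
    {Φ : PeriodicTrialState (m + 1) L} (hCC' : C ≤ C') (h : GDIneq v m L n C s Φ) :
    GDIneq v m L n C' s Φ := by
  unfold GDIneq at h ⊢
  refine h.trans (add_le_add le_rfl (ENNReal.ofReal_le_ofReal ?_))
  exact div_le_div_of_nonneg_right
    (mul_le_mul_of_nonneg_right (mul_le_mul_of_nonneg_right hCC' (sq_nonneg s)) (sq_nonneg L))
    (sq_nonneg _)

/-- `GDCanWith` is monotone in `C`. [folklore] -/
theorem GDCanWith.mono_C {ρ₀ C C' : ℝ} {N₀ : ℕ} {v : ℝ → ℝ≥0∞} {M : ℝ} (hCC' : C ≤ C')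
    (h : GDCanWith ρ₀ C N₀ v M) : GDCanWith ρ₀ C' N₀ v M :=
  fun m hm L hL hd n hn hw s hs Φ => (h m hm L hL hd n hn hw s hs Φ).mono_C hCC'

/-- The free gas `v = 0` is an admissible interaction. -/
theorem isRepulsiveFiniteRange_zero : IsRepulsiveFiniteRange 0 :=
  ⟨measurable_const, 0, fun _ _ => rfl⟩

/-- Extracting the real inequality from `GDIneq` for the free gas (dropping `E₀ ≥ 0`). -/
theorem real_of_gdIneq {m : ℕ} {n : Fin 3 → ℤ} {C s E : ℝ} {Φ : PeriodicTrialState (m + 1) L}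
    (hE : 0 ≤ E) (hEΦ : periodicEnergy 0 Φ = ENNReal.ofReal E)
    (hC : 0 ≤ C * s ^ 2 * L ^ 2 / ‖(fun j => (n j : ℝ))‖ ^ 2) (h : GDIneq 0 m L n C s Φ) :
    s * (2 * (m + 1) * ‖sourceIntegral m L n Φ.ψ‖) ≤
      E + C * s ^ 2 * L ^ 2 / ‖(fun j => (n j : ℝ))‖ ^ 2 := by
  unfold GDIneq at h
  rw [hEΦ, ← ENNReal.ofReal_add hE hC] at h
  exact (ENNReal.ofReal_le_ofReal_iff (add_nonneg hE hC)).mp (le_add_self.trans h)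

/-- `‖n‖∞ ≥ 1` for a non-zero integer vector. -/
theorem one_le_norm_intVec {n : Fin 3 → ℤ} (hn : n ≠ 0) : 1 ≤ ‖(fun j => (n j : ℝ))‖ := by
  obtain ⟨j, hj⟩ := Function.ne_iff.mp hn
  have h1 : (1 : ℝ) ≤ |(n j : ℝ)| := by
    rw [← Int.cast_abs]
    exact_mod_cast Int.one_le_abs hj
  calc (1 : ℝ) ≤ |(n j : ℝ)| := h1
    _ = ‖(fun j => (n j : ℝ)) j‖ := (Real.norm_eq_abs _).symm
    _ ≤ ‖(fun j => (n j : ℝ))‖ := norm_le_pi_norm (fun j : Fin 3 => (n j : ℝ)) j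

/-! ### Chord ⇔ square (the susceptibility form) -/

/-- For `0 < c`, `0 ≤ b`: `(∀ s ≥ 0, a + 2bs ≤ e + cs²) ↔ b² ≤ c(e - a)`. -/
theorem forall_chord_iff {a b c e : ℝ} (hc : 0 < c) (hb : 0 ≤ b) :
    (∀ s : ℝ, 0 ≤ s → a + 2 * b * s ≤ e + c * s ^ 2) ↔ b ^ 2 ≤ c * (e - a) := by
  constructor
  · intro h
    have h1 := h (b / c) (div_nonneg hb hc.le)
    have h2 : a + 2 * b * (b / c) - c * (b / c) ^ 2 = a + b ^ 2 / c := by field_simp; ring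
    have h3 : a + b ^ 2 / c ≤ e := by linarith [h1, h2]
    rw [← sub_nonneg] at h3 ⊢
    have h4 : c * (e - a) - b ^ 2 = c * (e - (a + b ^ 2 / c)) := by
      field_simp
      ring
    rw [h4]
    exact mul_nonneg hc.le h3
  · intro h s hs
    have key : 0 ≤ c * (e - a) - b ^ 2 := sub_nonneg.mpr h
    nlinarith [sq_nonneg (c * s - b), key, hc]

/-- **Square (susceptibility) form of the crux inequality.** For a trial state of finite energy,
`(∀ s ≥ 0, GDIneq)` says exactly `|⟨Φ, Λ_k† Φ⟩|² = (N‖I‖)² ≤ C (L/‖n‖∞)² (E(Φ) - E₀)`;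
for infinite energy it is empty. -/
theorem forall_gdIneq_iff {v : ℝ → ℝ≥0∞} {m : ℕ} {n : Fin 3 → ℤ} {C : ℝ} (hC : 0 < C) (hL : 0 < L)
    (hn : n ≠ 0) (Φ : PeriodicTrialState (m + 1) L) :
    (∀ s : ℝ, 0 ≤ s → GDIneq v m L n C s Φ) ↔
      (periodicEnergy v Φ ≠ ⊤ →
        ((m + 1 : ℝ) * ‖sourceIntegral m L n Φ.ψ‖) ^ 2 ≤
          C * L ^ 2 / ‖(fun j => (n j : ℝ))‖ ^ 2 *
            (periodicEnergy v Φ - periodicGroundStateEnergy v (m + 1) L).toReal) := by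
  have hnorm : 0 < ‖(fun j => (n j : ℝ))‖ :=
    lt_of_lt_of_le one_pos (one_le_norm_intVec hn)
  set c : ℝ := C * L ^ 2 / ‖(fun j => (n j : ℝ))‖ ^ 2 with hcdef
  have hc : 0 < c := by positivity
  set b : ℝ := (m + 1 : ℝ) * ‖sourceIntegral m L n Φ.ψ‖ with hbdef
  have hb : 0 ≤ b := by positivity
  by_cases htop : periodicEnergy v Φ = ⊤
  · simp only [htop, ne_eq, not_true_eq_false, false_implies, iff_true]
    intro s _
    unfold GDIneq
    rw [htop, top_add]
    exact le_top
  simp only [htop, ne_eq, not_false_eq_true, true_implies]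
  have hE0le : periodicGroundStateEnergy v (m + 1) L ≤ periodicEnergy v Φ :=
    periodicGroundStateEnergy_le v Φ
  have hE0top : periodicGroundStateEnergy v (m + 1) L ≠ ⊤ := ne_top_of_le_ne_top htop hE0le
  set a := (periodicGroundStateEnergy v (m + 1) L).toReal with hadef
  set e := (periodicEnergy v Φ).toReal with hedef
  rw [ENNReal.toReal_sub_of_le hE0le htop]
  have hchord : ∀ s : ℝ, 0 ≤ s → (GDIneq v m L n C s Φ ↔ a + 2 * b * s ≤ e + c * s ^ 2) := by
    intro s hs
    unfold GDIneq
    rw [← ENNReal.ofReal_toReal hE0top, ← ENNReal.ofReal_toReal htop, ← hadef, ← hedef,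
      ← ENNReal.ofReal_add ENNReal.toReal_nonneg (by positivity),
      ← ENNReal.ofReal_add ENNReal.toReal_nonneg (by positivity),
      ENNReal.ofReal_le_ofReal_iff (by positivity)]
    have e1 : s * (2 * (m + 1) * ‖sourceIntegral m L n Φ.ψ‖) = 2 * b * s := by rw [hbdef]; ring
    have e2 : C * s ^ 2 * L ^ 2 / ‖(fun j => (n j : ℝ))‖ ^ 2 = c * s ^ 2 := by rw [hcdef]; ring
    rw [e1, e2]
  rw [← forall_chord_iff hc hb]
  exact forall₂_congr fun s hs => hchord s hs

/-! ### The integer vector `e₀` and the top corner of the window -/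

/-- `e₀ = (1,0,0) ∈ ℤ³`. -/
def e0 : Fin 3 → ℤ := Pi.single 0 1

/-- `e₀ ≠ 0`. [folklore] -/
theorem e0_ne_zero : e0 ≠ 0 := by
  intro h
  have := congrFun h 0
  simp [e0] at this

/-- `‖e₀‖∞ = 1`. [folklore] -/
theorem norm_e0 : ‖(fun j => ((e0 j : ℤ) : ℝ))‖ = 1 := by
  have : (fun j => ((e0 j : ℤ) : ℝ)) = Pi.single (0 : Fin 3) (1 : ℝ) := by
    funext j
    fin_cases j <;> simp [e0]
  rw [this, Pi.norm_single, norm_one]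

/-- `|e₀|² = 1`. [folklore] -/
theorem nsq_e0 : nsq e0 = 1 := by
  simp [nsq, e0, Fin.sum_univ_three]

/-- **The top corner of the admissible region**: for `N ≥ 64π⁶/(ρ₀M⁶)` the side
`L = M²N/(4π²)` has density `≤ ρ₀` and `k = 2πe₀/L` sits exactly on the window edge
`|k| = M√ρ` (this is the ultra-dilute few-mode corner `ρ ~ N⁻²`, `kξ` fixed). -/
theorem corner {M ρ₀ : ℝ} (hM : 0 < M) (hρ : 0 < ρ₀) (m : ℕ)
    (hN : 64 * Real.pi ^ 6 / (ρ₀ * M ^ 6) ≤ ((m + 1 : ℕ) : ℝ)) :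
    0 < M ^ 2 * ((m + 1 : ℕ) : ℝ) / (4 * Real.pi ^ 2) ∧
    ((m + 1 : ℕ) : ℝ) ≤ ρ₀ * (M ^ 2 * ((m + 1 : ℕ) : ℝ) / (4 * Real.pi ^ 2)) ^ 3 ∧
    InWindow M m (M ^ 2 * ((m + 1 : ℕ) : ℝ) / (4 * Real.pi ^ 2)) e0 := by
  set N : ℝ := ((m + 1 : ℕ) : ℝ) with hNdef
  have hN1 : (1 : ℝ) ≤ N := by rw [hNdef]; exact_mod_cast Nat.succ_le_succ (Nat.zero_le m)
  have hNpos : 0 < N := by linarith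
  set L : ℝ := M ^ 2 * N / (4 * Real.pi ^ 2) with hLdef
  have hL : 0 < L := by positivity
  refine ⟨hL, ?_, ?_⟩
  · have h1 : 64 * Real.pi ^ 6 ≤ N * (ρ₀ * M ^ 6) := (div_le_iff₀ (by positivity)).mp hN
    have key : ρ₀ * L ^ 3 = ρ₀ * M ^ 6 * N * N ^ 2 / (64 * Real.pi ^ 6) := by
      rw [hLdef]; field_simp; ring
    rw [key, le_div_iff₀ (by positivity)]
    calc N * (64 * Real.pi ^ 6) ≤ N * (N * (ρ₀ * M ^ 6)) :=
          mul_le_mul_of_nonneg_left h1 hNpos.le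
      _ = ρ₀ * M ^ 6 * N ^ 2 := by ring
      _ ≤ ρ₀ * M ^ 6 * (N ^ 2 * N) :=
          mul_le_mul_of_nonneg_left (le_mul_of_one_le_right (sq_nonneg _) hN1) (by positivity)
      _ = ρ₀ * M ^ 6 * N * N ^ 2 := by ring
  · unfold InWindow
    rw [norm_e0, mul_one, ← hNdef]
    have hsq : (2 * Real.pi / L) ^ 2 ≤ (M * Real.sqrt (N / L ^ 3)) ^ 2 := by
      rw [mul_pow, Real.sq_sqrt (by positivity), div_pow,
        div_le_iff₀ (by positivity)]
      have hL4 : 4 * Real.pi ^ 2 * L = M ^ 2 * N := by rw [hLdef]; field_simp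
      have : M ^ 2 * (N / L ^ 3) * L ^ 2 = M ^ 2 * N / L := by field_simp
      rw [this, le_div_iff₀ hL]
      nlinarith [hL4]
    exact (pow_le_pow_iff_left₀ (by positivity) (by positivity) two_ne_zero).mp hsq

/-- Choice of `N`: given `N₀` and a real threshold, an `m` with `N₀ ≤ m+1` and `T ≤ m+1`. -/
theorem exists_large (N₀ : ℕ) (T : ℝ) : ∃ m : ℕ, N₀ ≤ m + 1 ∧ T ≤ ((m + 1 : ℕ) : ℝ) := by
  obtain ⟨K, hK⟩ := exists_nat_ge T
  refine ⟨N₀ + K, by omega, hK.trans ?_⟩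
  exact_mod_cast (show K ≤ N₀ + K + 1 by omega)

end Crux

/-! ## §C The guards `0 < M`, `0 < L`, `0 ≤ s` are decoration -/

section Guards

/-- `cell^N` is empty for `L ≤ 0` (`N ≥ 1`). [folklore] -/
theorem cellN_eq_empty {m : ℕ} (hL : L ≤ 0) : cellN (m + 1) L = ∅ := by
  ext X
  simp only [cellN, cell_eq_empty hL, Set.mem_empty_iff_false, Set.mem_setOf_eq, iff_false,
    not_forall]
  exact ⟨0, id⟩

/-- No periodic trial state exists on a box of non-positive side (the normalisation fails). -/
theorem isEmpty_periodicTrialState {m : ℕ} (hL : L ≤ 0) : IsEmpty (PeriodicTrialState (m + 1) L) :=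
  ⟨fun Φ => by
    have h := Φ.norm_eq
    rw [cellN_eq_empty hL, setLIntegral_empty] at h
    exact zero_ne_one h⟩

/-- For `M ≤ 0` the window is empty (its left end is `> 0`). -/
theorem not_inWindow_of_nonpos {M : ℝ} {m : ℕ} {n : Fin 3 → ℤ} (hM : M ≤ 0) (hL : 0 < L)
    (hn : n ≠ 0) : ¬ InWindow M m L n := by
  unfold InWindow
  intro h
  have h1 : 0 < 2 * Real.pi * ‖(fun j => (n j : ℝ))‖ / L := by
    have := one_le_norm_intVec hn
    positivity
  have h2 : M * Real.sqrt ((m + 1 : ℕ) / L ^ 3) ≤ 0 :=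
    mul_nonpos_of_nonpos_of_nonneg hM (Real.sqrt_nonneg _)
  linarith

/-- For `s ≤ 0` the crux inequality is the variational principle. -/
theorem gdIneq_of_nonpos {v : ℝ → ℝ≥0∞} {m : ℕ} {n : Fin 3 → ℤ} {C s : ℝ} (hs : s ≤ 0)
    (Φ : PeriodicTrialState (m + 1) L) : GDIneq v m L n C s Φ := by
  unfold GDIneq
  rw [ENNReal.ofReal_of_nonpos (mul_nonpos_of_nonpos_of_nonneg hs (by positivity)), add_zero]
  exact (periodicGroundStateEnergy_le v Φ).trans le_self_add

/-- The crux with the three guards `0 < M`, `0 < L`, `0 ≤ s` deleted. -/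
def GaussianDominationCanBare : Prop :=
  ∀ v : ℝ → ℝ≥0∞, IsRepulsiveFiniteRange v → ∀ M : ℝ, ∃ ρ₀ C : ℝ, 0 < ρ₀ ∧ 0 < C ∧ ∃ N₀ : ℕ,
    ∀ m : ℕ, N₀ ≤ m + 1 → ∀ L : ℝ, ((m + 1 : ℕ) : ℝ) ≤ ρ₀ * L ^ 3 →
      ∀ n : Fin 3 → ℤ, n ≠ 0 → InWindow M m L n → ∀ s : ℝ,
        ∀ Φ : PeriodicTrialState (m + 1) L, GDIneq v m L n C s Φ

/-- **The guards are decoration**: `0 < M` (else the window is empty), `0 < L` (else there is no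
trial state) and `0 ≤ s` (else the inequality is the variational principle) can all be dropped. -/
theorem gaussianDominationCan_iff_bare :
    Summit.AtomisticToContinuum.BoseEinsteinCondensation.Theses.BECThomsonPrinciple.GaussianDominationCan ↔
      GaussianDominationCanBare := by
  rw [gaussianDominationCan_iff]
  constructor
  · intro h v hv M
    by_cases hM : 0 < M
    · obtain ⟨ρ₀, C, hρ, hC, N₀, hG⟩ := h v hv M hM
      refine ⟨ρ₀, C, hρ, hC, N₀, fun m hm L hd n hn hw s Φ => ?_⟩
      by_cases hL : 0 < L
      · by_cases hs : 0 ≤ s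
        · exact hG m hm L hL hd n hn hw s hs Φ
        · exact gdIneq_of_nonpos (le_of_not_ge hs) Φ
      · exact ((isEmpty_periodicTrialState (le_of_not_gt hL)).false Φ).elim
    · refine ⟨1, 1, one_pos, one_pos, 0, fun m _ L _ n hn hw s Φ => ?_⟩
      by_cases hL : 0 < L
      · exact (not_inWindow_of_nonpos (le_of_not_gt hM) hL hn hw).elim
      · exact ((isEmpty_periodicTrialState (le_of_not_gt hL)).false Φ).elim
  · intro h v hv M _
    obtain ⟨ρ₀, C, hρ, hC, N₀, hG⟩ := h v hv M
    exact ⟨ρ₀, C, hρ, hC, N₀, fun m hm L _ hd n hn hw s _ Φ => hG m hm L hd n hn hw s Φ⟩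

end Guards

end Summit.AtomisticToContinuum.BoseEinsteinCondensation.Theorems.GaussianDominationCan.Negative

end
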